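import Mathlib
import Literature.Analysis.Calculus.PlanarPolarIntegral
import Literature.Analysis.FluidPDE.CylindricalIntegration
import HarnessLib

/-!
# Local integrability of negative powers of the distance to an axis:
# `∫_{B(x₀, r)} ϱ^{-s} dx ≤ C_s r^{3-s}` for `s < 2` (`ϱ = |x'|`, the cylindrical radius)

Nazarov–Uraltseva, St. Petersburg Math. J. 23 (2012) 93–115 = arXiv:1011.1888, §4 (arXiv p. 14): the model singular drift
`b̂ = -(n-2)x'/|x'|²` about an axis has `|b̂| ∼ 1/ϱ ∈ L_{q,loc}` for every `q < 2`, with the SCALE-FREE bound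
`R^{1-3/q}‖b̂‖_{q,B_R} ≤ c_q` uniformly in the centre of the ball (the worst centre is on the axis).  In the form used by
analysts of axisymmetric flows: for `0 ≤ s < 2` there is `C_s` with `∫_{B(x₀,r)} ϱ^{-s} dx ≤ C_s r^{3-s}` for all centres
`x₀ ∈ ℝ³` and radii `r > 0` (cylindrical coordinates: the part of the ball inside the cylinder `{ϱ < r, |x₃ − (x₀)₃| < r}`
contributes `≤ 2r · 2π · ∫₀^r ρ^{1-s} dρ = (4π/(2-s)) r^{3-s}`, the part with `ϱ ≥ r` contributes `≤ r^{-s}|B_r|`).  This is the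
integrability that makes Hölder estimates against axis weights `ϱ^{-s}` (vorticity `ω_θ/ϱ`, swirl `u_θ/ϱ`, the drift `x'/|x'|²`)
scale correctly.

Route-independent home of the computation (lower Lebesgue integrals throughout, no integrability provisos):

* `lintegral_eq_lintegral_planePolar` / `lintegral_eq_lintegral_cylindrical` — Tonelli in polar coordinates on
  `EuclideanSpace ℝ (Fin 2)` and in cylindrical coordinates on `EuclideanSpace ℝ (Fin 3)` for `∫⁻` (Mathlib's
  `lintegral_comp_polarCoord_symm` transported along the tree's volume-preserving identifications
  `measurePreserving_toLp_fin_two` (`PlanarPolarIntegral`) and `cylSplit` (`CylindricalIntegration`));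
* (private) `lintegral_rpow_one_sub_Ioo` — `∫₀^r ρ^{1-s} dρ = r^{2-s}/(2-s)`;
* `lintegral_inv_cylRadius_rpow_axisCylinder_le` — the cylinder about the axis;
* **`lintegral_inv_cylRadius_rpow_ball_le`** — the ball bound, uniform in the centre.

(Adapted from the crux-local copy in `Summits/NavierStokesRegularity/…/Theorems/AxisymmetricExtremalityAxisymmetricKatoGlobalStub
Seregin2020TypeIILemma22InvCylRadius.lean` + `…StubSereginLogSwirlOriginLerayLogHardy.lean`, namespace `…AxisymmetricKatoGlobal.EulerScaling`,
so that users outside that route need not import a Theses cone.)  Mathlib has polar coordinates (`polarCoord`,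
`lintegral_comp_polarCoord_symm`) but no cylindrical-coordinate Tonelli and no axis-weight bound.

## References

* A. I. Nazarov, N. N. Uraltseva, *The Harnack inequality and related properties for solutions of elliptic and parabolic
  equations with divergence-free lower-order coefficients*, St. Petersburg Math. J. 23 (2012) 93–115 = arXiv:1011.1888, §4
  (the drift `b̂` and the constant `c_q`, arXiv p. 14). [NazarovUraltseva2012]
* G. Seregin, Anal. Math. Phys. 10 (2020), Paper 46 = arXiv:2006.04140, Lemma 2.2 (where the bound is used). [Seregin2020]
-/

noncomputable section

open Set MeasureTheory Filter Function Metric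
open scoped ENNReal NNReal

namespace Literature.Analysis.FluidPDE

open _root_.MeasureTheory _root_.Set

/-! ### Polar and cylindrical coordinates for lower Lebesgue integrals -/

/-- The polar map `(ρ, θ) ↦ (ρ cos θ, ρ sin θ)` into `EuclideanSpace ℝ (Fin 2)` is continuous (private plumbing). [folklore] -/
private theorem continuous_planePolarPt :
    Continuous fun p : ℝ × ℝ => (WithLp.toLp 2 ![p.1 * Real.cos p.2, p.1 * Real.sin p.2] : EuclideanSpace ℝ (Fin 2)) := by
  -- adapted from Summits/…/Theorems/AxisymmetricExtremalityAxisymmetricKatoGlobalStubSereginLogSwirlOriginLerayLogHardy.lean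
  refine (PiLp.continuous_toLp 2 _).comp (continuous_pi fun i => ?_)
  fin_cases i
  · exact continuous_fst.mul (Real.continuous_cos.comp continuous_snd)
  · exact continuous_fst.mul (Real.continuous_sin.comp continuous_snd)

/-- **Tonelli in polar coordinates on `EuclideanSpace ℝ (Fin 2)`** (lower Lebesgue integrals, no integrability proviso):
`∫⁻ F = ∫⁻_{θ ∈ (-π, π)} ∫⁻_{ρ > 0} ρ F(ρ cos θ, ρ sin θ)` — the change of variables to polar coordinates for
non-negative measurable integrands (Evans–Gariepy, §3.4.4 C "polar coordinates"; Mathlib `lintegral_comp_polarCoord_symm` on `ℝ × ℝ`).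
[cite: EvansGariepy2015, §3.4.4 (polar coordinates)] -/
theorem lintegral_eq_lintegral_planePolar {F : EuclideanSpace ℝ (Fin 2) → ℝ≥0∞} (hF : Measurable F) :
    ∫⁻ w, F w = ∫⁻ θ in Ioo (-Real.pi) Real.pi, ∫⁻ ρ in Ioi (0 : ℝ),
      ENNReal.ofReal ρ * F (WithLp.toLp 2 ![ρ * Real.cos θ, ρ * Real.sin θ]) := by
  -- adapted from …StubSereginLogSwirlOriginLerayLogHardy.lean (`EulerScaling.lintegral_eq_lintegral_polar`)
  have h1 : ∫⁻ w, F w = ∫⁻ q : ℝ × ℝ, F (WithLp.toLp 2 ![q.1, q.2]) :=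
    (Calculus.measurePreserving_toLp_fin_two.lintegral_comp_emb Calculus.measurableEmbedding_toLp_fin_two F).symm
  have h2 := lintegral_comp_polarCoord_symm (fun q : ℝ × ℝ => F (WithLp.toLp 2 ![q.1, q.2]))
  rw [h1, ← h2, Calculus.volume_restrict_polarCoord_target]
  simp only [polarCoord_symm_apply, smul_eq_mul]
  have hm : Measurable fun p : ℝ × ℝ =>
      ENNReal.ofReal p.1 * F (WithLp.toLp 2 ![p.1 * Real.cos p.2, p.1 * Real.sin p.2]) :=
    (ENNReal.measurable_ofReal.comp measurable_fst).mul (hF.comp continuous_planePolarPt.measurable)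
  rw [lintegral_prod_symm _ hm.aemeasurable]

/-- **Tonelli in cylindrical coordinates on `EuclideanSpace ℝ (Fin 3)`** (lower Lebesgue integrals):
`∫⁻ G = ∫⁻_z ∫⁻_{θ ∈ (-π, π)} ∫⁻_{ρ > 0} ρ G(ρ cos θ, ρ sin θ, z)` — Fubini in `(x₃, x')` followed by planar polar
coordinates, for non-negative measurable integrands (Evans–Gariepy, §1.4 Fubini + §3.4.4 C polar coordinates).
[cite: EvansGariepy2015, §3.4.4 (polar coordinates, with Fubini §1.4)] -/
theorem lintegral_eq_lintegral_cylindrical {G : EuclideanSpace ℝ (Fin 3) → ℝ≥0∞} (hG : Measurable G) :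
    ∫⁻ x, G x = ∫⁻ z : ℝ, ∫⁻ θ in Ioo (-Real.pi) Real.pi, ∫⁻ ρ in Ioi (0 : ℝ),
      ENNReal.ofReal ρ * G (WithLp.toLp 2 ![ρ * Real.cos θ, ρ * Real.sin θ, z]) := by
  -- adapted from …StubSereginLogSwirlOriginLerayLogHardy.lean (`EulerScaling.lintegral_eq_lintegral_cylindrical`)
  have h1 : ∫⁻ x, G x = ∫⁻ p : ℝ × EuclideanSpace ℝ (Fin 2), G (cylSplit.symm p) :=
    (measurePreserving_cylSplit_symm.lintegral_comp_emb cylSplit.symm.measurableEmbedding G).symm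
  have hGm : Measurable fun p : ℝ × EuclideanSpace ℝ (Fin 2) => G (cylSplit.symm p) :=
    hG.comp cylSplit.symm.measurable
  rw [h1, Measure.volume_eq_prod, lintegral_prod _ hGm.aemeasurable]
  refine lintegral_congr fun z => ?_
  rw [lintegral_eq_lintegral_planePolar (F := fun w => G (cylSplit.symm (z, w))) (hGm.comp measurable_prodMk_left)]
  simp only [cylSplit_symm_apply, Matrix.cons_val_zero, Matrix.cons_val_one]

/-- The cylindrical radius of the point `(ρ cos θ, ρ sin θ, z)` is `|ρ|` (private plumbing). [folklore] -/
private theorem cylRadius_cylindricalPt (ρ θ z : ℝ) :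
    cylRadius (WithLp.toLp 2 ![ρ * Real.cos θ, ρ * Real.sin θ, z] : EuclideanSpace ℝ (Fin 3)) = |ρ| := by
  rw [cylRadius]
  have e : (ρ * Real.cos θ) ^ 2 + (ρ * Real.sin θ) ^ 2 = ρ ^ 2 := by
    linear_combination ρ ^ 2 * Real.sin_sq_add_cos_sq θ
  simp only [Matrix.cons_val_zero, Matrix.cons_val_one]
  rw [e, Real.sqrt_sq_eq_abs]

/-! ### The axis weight `ϱ^{-s}`, `s < 2` -/

/-- `∫₀^r ρ^{1-s} dρ = r^{2-s}/(2-s)` for `s < 2`, as a lower Lebesgue integral (private plumbing). [folklore] -/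
private theorem lintegral_rpow_one_sub_Ioo {s : ℝ} (hs : s < 2) {r : ℝ} (hr : 0 < r) :
    ∫⁻ ρ in Ioo (0 : ℝ) r, ENNReal.ofReal (ρ ^ (1 - s)) = ENNReal.ofReal (r ^ (2 - s) / (2 - s)) := by
  -- adapted from …Seregin2020TypeIILemma22InvCylRadius.lean (`EulerScaling.lintegral_rpow_one_sub_Ioo`)
  have h1 : -1 < 1 - s := by linarith
  have hint : IntegrableOn (fun ρ : ℝ => ρ ^ (1 - s)) (Ioo 0 r) := by
    have h := (intervalIntegral.intervalIntegrable_rpow' h1 (a := 0) (b := r))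
    rw [intervalIntegrable_iff_integrableOn_Ioo_of_le hr.le] at h
    exact h
  have hnn : 0 ≤ᵐ[volume.restrict (Ioo (0 : ℝ) r)] fun ρ : ℝ => ρ ^ (1 - s) :=
    (ae_restrict_iff' measurableSet_Ioo).2 (Eventually.of_forall fun ρ hρ =>
      Real.rpow_nonneg hρ.1.le _)
  rw [← ofReal_integral_eq_lintegral_ofReal hint hnn]
  congr 1
  rw [← integral_Ioc_eq_integral_Ioo, ← intervalIntegral.integral_of_le hr.le, integral_rpow (Or.inl h1),
    Real.zero_rpow (by linarith : 1 - s + 1 ≠ 0), sub_zero]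
  congr 1 <;> ring_nf

/-- **`∫ ϱ^{-s}` over a cylinder about the axis.** For `s < 2`, `h ∈ ℝ` and `r > 0`,
`∫⁻_{ {ϱ < r, x₃ ∈ ]h-r, h+r[} } ϱ^{-s} dx ≤ (4π/(2-s)) r^{3-s}` (cylindrical coordinates: `= 2r · 2π · ∫₀^r ρ^{1-s} dρ`).
[cite: NazarovUraltseva2012, §4, the constant c_q of the drift x'/|x'|² (arXiv p. 14)] -/
theorem lintegral_inv_cylRadius_rpow_axisCylinder_le {s : ℝ} (hs : s < 2) (h : ℝ) {r : ℝ} (hr : 0 < r) :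
    ∫⁻ x in {x : EuclideanSpace ℝ (Fin 3) | cylRadius x < r ∧ x 2 ∈ Ioo (h - r) (h + r)},
        ENNReal.ofReal (cylRadius x ^ (-s)) ≤
      ENNReal.ofReal (4 * Real.pi / (2 - s) * r ^ (3 - s)) := by
  -- adapted from …Seregin2020TypeIILemma22InvCylRadius.lean (`EulerScaling.lintegral_inv_cylRadius_rpow_axisCylinder_le`)
  set S : Set (EuclideanSpace ℝ (Fin 3)) := {x | cylRadius x < r ∧ x 2 ∈ Ioo (h - r) (h + r)} with hS
  have h2c : Continuous fun x : EuclideanSpace ℝ (Fin 3) => x 2 := by fun_prop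
  have hSm : MeasurableSet S :=
    ((isOpen_lt continuous_cylRadius continuous_const).inter (isOpen_Ioo.preimage h2c)).measurableSet
  set f : EuclideanSpace ℝ (Fin 3) → ℝ≥0∞ := fun x => ENNReal.ofReal (cylRadius x ^ (-s)) with hf
  have hfm : Measurable f :=
    ENNReal.measurable_ofReal.comp (continuous_cylRadius.measurable.pow_const _)
  -- the one-dimensional factors
  set I₁ : ℝ → ℝ≥0∞ := (Ioo (h - r) (h + r)).indicator 1 with hI₁
  set I₂ : ℝ → ℝ≥0∞ := (Iio r).indicator fun ρ => ENNReal.ofReal (ρ ^ (1 - s)) with hI₂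
  have hI₂m : Measurable I₂ :=
    (ENNReal.measurable_ofReal.comp (measurable_id.pow_const _)).indicator measurableSet_Iio
  -- the integrand in cylindrical coordinates
  have hpt : ∀ (z θ : ℝ), ∀ ρ ∈ Ioi (0 : ℝ), ENNReal.ofReal ρ *
      S.indicator f (WithLp.toLp 2 ![ρ * Real.cos θ, ρ * Real.sin θ, z]) = I₁ z * I₂ ρ := by
    intro z θ ρ hρ
    have hρ0 : 0 < ρ := hρ
    have hrad : cylRadius (WithLp.toLp 2 ![ρ * Real.cos θ, ρ * Real.sin θ, z] : EuclideanSpace ℝ (Fin 3)) = ρ := by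
      rw [cylRadius_cylindricalPt, abs_of_pos hρ0]
    have hmem : (WithLp.toLp 2 ![ρ * Real.cos θ, ρ * Real.sin θ, z] : EuclideanSpace ℝ (Fin 3)) ∈ S ↔
        ρ < r ∧ z ∈ Ioo (h - r) (h + r) := by
      simp only [hS, mem_setOf_eq, hrad]
      rfl
    by_cases hz : z ∈ Ioo (h - r) (h + r)
    · by_cases hρr : ρ < r
      · rw [indicator_of_mem (hmem.2 ⟨hρr, hz⟩), hI₁, hI₂, indicator_of_mem hz,
          indicator_of_mem (show ρ ∈ Iio r from hρr), Pi.one_apply, one_mul, hf]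
        beta_reduce
        rw [hrad, ← ENNReal.ofReal_mul hρ0.le]
        congr 1
        rw [show (1 : ℝ) - s = 1 + -s by ring, Real.rpow_add hρ0, Real.rpow_one]
      · rw [indicator_of_notMem (fun hm => hρr (hmem.1 hm).1), hI₂,
          indicator_of_notMem (show ρ ∉ Iio r from hρr), mul_zero, mul_zero]
    · rw [indicator_of_notMem (fun hm => hz (hmem.1 hm).2), hI₁, indicator_of_notMem hz,
        zero_mul, mul_zero]
  -- Tonelli in cylindrical coordinates
  rw [← lintegral_indicator hSm, lintegral_eq_lintegral_cylindrical (hfm.indicator hSm)]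
  have hinner : ∀ z θ : ℝ, ∫⁻ ρ in Ioi (0 : ℝ), ENNReal.ofReal ρ *
      S.indicator f (WithLp.toLp 2 ![ρ * Real.cos θ, ρ * Real.sin θ, z]) =
      I₁ z * ENNReal.ofReal (r ^ (2 - s) / (2 - s)) := by
    intro z θ
    rw [setLIntegral_congr_fun measurableSet_Ioi (hpt z θ), lintegral_const_mul _ hI₂m, hI₂,
      lintegral_indicator measurableSet_Iio, Measure.restrict_restrict measurableSet_Iio,
      Iio_inter_Ioi, lintegral_rpow_one_sub_Ioo hs hr]
  have hI₁m : Measurable I₁ := measurable_one.indicator measurableSet_Ioo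
  simp_rw [hinner, setLIntegral_const, mul_assoc]
  rw [lintegral_mul_const _ hI₁m, hI₁, lintegral_indicator_one measurableSet_Ioo, Real.volume_Ioo,
    Real.volume_Ioo]
  have h2s : 0 < 2 - s := by linarith
  have hb : 0 ≤ r ^ (2 - s) / (2 - s) := div_nonneg (Real.rpow_nonneg hr.le _) h2s.le
  have ha : 0 ≤ h + r - (h - r) := by linarith
  have e1 : r ^ (3 - s) = r * r ^ (2 - s) := by
    rw [show (3 : ℝ) - s = 1 + (2 - s) by ring, Real.rpow_add hr, Real.rpow_one]
  have e : ENNReal.ofReal (h + r - (h - r)) *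
      (ENNReal.ofReal (r ^ (2 - s) / (2 - s)) * ENNReal.ofReal (Real.pi - -Real.pi)) =
      ENNReal.ofReal (4 * Real.pi / (2 - s) * r ^ (3 - s)) := by
    rw [← ENNReal.ofReal_mul hb, ← ENNReal.ofReal_mul ha]
    congr 1
    rw [e1]
    field_simp
    ring
  rw [e]

/-- **Nazarov–Uraltseva's scale-free bound: `ϱ^{-s}` is integrable on balls, uniformly in the centre.**  For `0 ≤ s < 2` there
is a constant `C` (depending on `s` only) such that for every `x₀ ∈ ℝ³` and `r > 0`, `∫⁻_{B(x₀, r)} ϱ^{-s} dx ≤ C r^{3-s}`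
(`ϱ = cylRadius = |x'|`; split the ball into its part inside the cylinder `{ϱ < r, |x₃ − (x₀)₃| < r}` and the part where
`ϱ ≥ r`, on which `ϱ^{-s} ≤ r^{-s}`).  This is `b̂ ∈ L_{q,∞,loc}`, `R^{1-3/q}‖b̂‖_{q,B_R} ≤ c_q` for `q < 2`, of the cited source.
[cite: NazarovUraltseva2012, §4, b̂ ∈ L_{q,loc} for q < 2 and the constant c_q (arXiv p. 14)] -/
theorem lintegral_inv_cylRadius_rpow_ball_le : ∀ s : ℝ, 0 ≤ s → s < 2 → ∃ C : ℝ≥0,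
    ∀ (x₀ : EuclideanSpace ℝ (Fin 3)) (r : ℝ), 0 < r →
      ∫⁻ x in ball x₀ r, ENNReal.ofReal (cylRadius x ^ (-s)) ≤ (C : ℝ≥0∞) * ENNReal.ofReal (r ^ (3 - s)) := by
  -- adapted from …Seregin2020TypeIILemma22InvCylRadius.lean (`EulerScaling.lintegral_inv_cylRadius_rpow_ball_le`)
  intro s hs0 hs2
  -- the constant: `4π/(2-s)` for the cylinder part, `|B(0,1)|` for the far part
  set V : ℝ≥0∞ := volume (ball (0 : EuclideanSpace ℝ (Fin 3)) 1) with hV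
  have hVlt : V < ∞ := measure_ball_lt_top
  set K : ℝ≥0∞ := ENNReal.ofReal (4 * Real.pi / (2 - s)) + V with hK
  have hKlt : K < ∞ := ENNReal.add_lt_top.2 ⟨ENNReal.ofReal_lt_top, hVlt⟩
  refine ⟨K.toNNReal, fun x₀ r hr => ?_⟩
  rw [ENNReal.coe_toNNReal hKlt.ne]
  set f : EuclideanSpace ℝ (Fin 3) → ℝ≥0∞ := fun x => ENNReal.ofReal (cylRadius x ^ (-s)) with hf
  set A : Set (EuclideanSpace ℝ (Fin 3)) := {x | cylRadius x < r ∧ x 2 ∈ Ioo (x₀ 2 - r) (x₀ 2 + r)} with hA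
  set B : Set (EuclideanSpace ℝ (Fin 3)) := ball x₀ r ∩ {x | r ≤ cylRadius x} with hB
  -- the ball lies in `A ∪ B`
  have hsub : ball x₀ r ⊆ A ∪ B := by
    intro x hx
    by_cases hxr : cylRadius x < r
    · refine Or.inl ⟨hxr, ?_⟩
      have h2 : |x 2 - x₀ 2| < r := by
        have h := PiLp.norm_apply_le (x - x₀) 2
        rw [mem_ball, dist_eq_norm] at hx
        simp only [PiLp.sub_apply, Real.norm_eq_abs] at h
        exact lt_of_le_of_lt h hx
      rw [abs_lt] at h2
      exact ⟨by linarith [h2.1], by linarith [h2.2]⟩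
    · exact Or.inr ⟨hx, not_lt.1 hxr⟩
  -- the far part
  have hBle : ∫⁻ x in B, f x ≤ V * ENNReal.ofReal (r ^ (3 - s)) := by
    have hBm : MeasurableSet B :=
      measurableSet_ball.inter (isClosed_le continuous_const continuous_cylRadius).measurableSet
    calc ∫⁻ x in B, f x ≤ ∫⁻ x in B, ENNReal.ofReal (r ^ (-s)) := by
          refine setLIntegral_mono' hBm fun x hx => ?_
          exact ENNReal.ofReal_le_ofReal (Real.rpow_le_rpow_of_nonpos hr hx.2 (by linarith))
      _ = ENNReal.ofReal (r ^ (-s)) * volume B := setLIntegral_const _ _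
      _ ≤ ENNReal.ofReal (r ^ (-s)) * volume (ball x₀ r) := by gcongr; exact inter_subset_left
      _ = ENNReal.ofReal (r ^ (-s)) * (ENNReal.ofReal (r ^ 3) * V) := by
          rw [Measure.addHaar_ball volume x₀ hr.le, finrank_euclideanSpace_fin]
      _ = V * ENNReal.ofReal (r ^ (3 - s)) := by
          rw [← mul_assoc, ← ENNReal.ofReal_mul (Real.rpow_nonneg hr.le _), mul_comm]
          congr 2
          rw [Real.rpow_sub hr, Real.rpow_neg hr.le, div_eq_mul_inv, mul_comm]
          norm_cast
  -- the cylinder part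
  have h2s : 0 < 2 - s := by linarith
  have hAle : ∫⁻ x in A, f x ≤ ENNReal.ofReal (4 * Real.pi / (2 - s)) * ENNReal.ofReal (r ^ (3 - s)) := by
    rw [← ENNReal.ofReal_mul (by positivity)]
    exact lintegral_inv_cylRadius_rpow_axisCylinder_le hs2 (x₀ 2) hr
  calc ∫⁻ x in ball x₀ r, f x ≤ ∫⁻ x in A ∪ B, f x := lintegral_mono_set hsub
    _ ≤ (∫⁻ x in A, f x) + ∫⁻ x in B, f x := lintegral_union_le _ _ _
    _ ≤ ENNReal.ofReal (4 * Real.pi / (2 - s)) * ENNReal.ofReal (r ^ (3 - s)) + V * ENNReal.ofReal (r ^ (3 - s)) :=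
        add_le_add hAle hBle
    _ = K * ENNReal.ofReal (r ^ (3 - s)) := by rw [hK, add_mul]

end Literature.Analysis.FluidPDE

end
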